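import Summits.AtomisticToContinuum.Crystallization.Theses.HullExactificationCascade

/-!
# Definitions for `HullGoodEverywhere` (route `HullExactificationCascade`, support item D,
# stmt-AtomisticToContinuum-12089)

The route inlines its "`1/20`-good first shell" predicate; to prove item D we name it.

* `SiteGood S y` — VERBATIM the inlined clause of `ZeroDefectDensity` / `HullGoodEverywhere` /
  `RobustBarlowTemplate` for a point `y` of a point set `S ⊆ ℝ³`: with `d` the distance from `y` to
  `S ∖ {y}` (an `sInf`) and `T` the other points of `S` within `13/10 · d` of `y`, some linear
  isometry `A` and some bijection `e` of `T` with the fcc or the hcp kissing pattern put every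
  rescaled, recentred point `d⁻¹ (t - y)` within `1/20` of `A (e t)`.  For a finite configuration
  `x : Fin N → ℝ³` the route's predicate at particle `i` is `SiteGood (Set.range x) (x i)`
  (`hullGoodEverywhere_iff` is `Iff.rfl`).
* `PatternGood P R₀ S y` — the same for ONE pattern `P` (a `Finset`), together with the scale
  bound `d ≤ R₀`; the form that passes to local limits pattern by pattern.
* `nearPt Y z` — a point of `Y` within distance `1` of `z` minimising the distance to `z` when
  there is one (else `z`); used to follow a point of a local limit back along the approximating
  configurations.

No facts are asserted here; the API is in the sibling proof files.
-/

noncomputable section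

namespace Summit.AtomisticToContinuum.Crystallization.Theorems

open Summit.AtomisticToContinuum.Crystallization.Theses.HullExactificationCascade
open Literature.MathematicalPhysics.StatisticalMechanics Literature.Geometry.DiscreteGeometry
open Filter Topology

/-- **The route's goodness predicate, named.** `y` is a `1/20`-good site of the point set
`S ⊆ ℝ³`: with `d := dist(y, S ∖ {y})` and `T` the points of `S ∖ {y}` within `13/10 · d` of
`y`, after rescaling by `d⁻¹` and recentring at `y` the shell `T` is matched pointwise within
`1/20`, through a bijection, to a linearly isometric copy of the fcc or of the hcp kissing pattern.
Verbatim the clause inlined in `ZeroDefectDensity`, `HullGoodEverywhere`, `RobustBarlowTemplate`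
(a predicate, not a fact). [folklore] -/
def SiteGood (S : Set (EuclideanSpace ℝ (Fin 3))) (y : EuclideanSpace ℝ (Fin 3)) : Prop :=
  let d : ℝ := sInf ((fun z => dist z y) '' (S \ {y}))
  let T : Set (EuclideanSpace ℝ (Fin 3)) :=
    {z : EuclideanSpace ℝ (Fin 3) | z ∈ S ∧ z ≠ y ∧ dist z y < 13 / 10 * d}
  ∃ A : EuclideanSpace ℝ (Fin 3) →ₗᵢ[ℝ] EuclideanSpace ℝ (Fin 3),
    (∃ e : ↥T ≃ ↥Literature.Geometry.DiscreteGeometry.fccKissingPattern, ∀ t : ↥T,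
      dist (d⁻¹ • ((t : EuclideanSpace ℝ (Fin 3)) - y))
        (A ((e t : ↥Literature.Geometry.DiscreteGeometry.fccKissingPattern) :
          EuclideanSpace ℝ (Fin 3))) ≤ 1 / 20) ∨
    (∃ e : ↥T ≃ ↥Literature.Geometry.DiscreteGeometry.hcpKissingPattern, ∀ t : ↥T,
      dist (d⁻¹ • ((t : EuclideanSpace ℝ (Fin 3)) - y))
        (A ((e t : ↥Literature.Geometry.DiscreteGeometry.hcpKissingPattern) :
          EuclideanSpace ℝ (Fin 3))) ≤ 1 / 20)

/-- **Goodness for one pattern, with a scale bound.** `PatternGood P R₀ S y`: the local scale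
`d := dist(y, S ∖ {y})` is `≤ R₀` and the rescaled, recentred shell of `y` in `S` (points of
`S ∖ {y}` within `13/10 · d`) is matched within `1/20`, through a bijection, to a linearly
isometric copy of the pattern `P`.  (`SiteGood` is the disjunction over the two patterns without
the scale bound.) A predicate, not a fact. [folklore] -/
def PatternGood (P : Finset (EuclideanSpace ℝ (Fin 3))) (R₀ : ℝ) (S : Set (EuclideanSpace ℝ (Fin 3)))
    (y : EuclideanSpace ℝ (Fin 3)) : Prop :=
  let d : ℝ := sInf ((fun z => dist z y) '' (S \ {y}))
  let T : Set (EuclideanSpace ℝ (Fin 3)) :=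
    {z : EuclideanSpace ℝ (Fin 3) | z ∈ S ∧ z ≠ y ∧ dist z y < 13 / 10 * d}
  d ≤ R₀ ∧ ∃ A : EuclideanSpace ℝ (Fin 3) →ₗᵢ[ℝ] EuclideanSpace ℝ (Fin 3), ∃ e : ↥T ≃ ↥P,
    ∀ t : ↥T, dist (d⁻¹ • ((t : EuclideanSpace ℝ (Fin 3)) - y))
      (A ((e t : ↥P) : EuclideanSpace ℝ (Fin 3))) ≤ 1 / 20

/-- **A nearest approximant.** If some point of `Y` lies within distance `1` of `z` and minimises
the distance to `z` among such points, `nearPt Y z` is such a point; otherwise it is `z` itself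
(junk value).  For a uniformly discrete `Y` the minimiser exists as soon as `Y` meets the closed
unit ball about `z`. [folklore] -/
def nearPt (Y : Set (EuclideanSpace ℝ (Fin 3))) (z : EuclideanSpace ℝ (Fin 3)) :
    EuclideanSpace ℝ (Fin 3) :=
  by
    classical
    exact if h : ∃ a ∈ Y, dist a z ≤ 1 ∧ ∀ b ∈ Y, dist b z ≤ 1 → dist a z ≤ dist b z
      then h.choose else z

/-- `HullGoodEverywhere` with the inlined predicate replaced by its name (definitional).
[folklore] -/
theorem hullGoodEverywhere_iff :
    HullGoodEverywhere ↔
      ∀ (x : (N : ℕ) → (Fin N → EuclideanSpace ℝ (Fin 3))),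
        (∀ N, IsGroundState lennardJones (x N)) →
        Tendsto (fun N : ℕ =>
          (Nat.card {i : Fin N // ¬ SiteGood (Set.range (x N)) (x N i)} : ℝ) / (N : ℝ))
          atTop (nhds (0 : ℝ)) →
        ∃ S : Set (EuclideanSpace ℝ (Fin 3)), ∃ δ : ℝ, 0 < δ ∧
          (∀ y ∈ S, ∀ z ∈ S, y ≠ z → δ ≤ dist y z) ∧ (0 : EuclideanSpace ℝ (Fin 3)) ∈ S ∧
          (∃ φ : ℕ → ℕ, StrictMono φ ∧ ∃ τ : ℕ → EuclideanSpace ℝ (Fin 3), ∀ R ε : ℝ, 0 < ε →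
            ∀ᶠ j : ℕ in atTop,
              (∀ s ∈ S, ‖s‖ ≤ R → ∃ i : Fin (φ j), dist (x (φ j) i + τ j) s ≤ ε) ∧
              (∀ i : Fin (φ j), ‖x (φ j) i + τ j‖ ≤ R → ∃ s ∈ S, dist (x (φ j) i + τ j) s ≤ ε)) ∧
          (∀ y ∈ S, SiteGood S y) ∧
          (∃ R₁ : ℝ, ∀ p : EuclideanSpace ℝ (Fin 3), ∃ y ∈ S, dist y p ≤ R₁) :=
  Iff.rfl

/-- `SiteGood` restated through `PatternGood` without the scale bound: for every `R₀` at least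
the local scale, `SiteGood S y ↔ PatternGood fcc R₀ S y ∨ PatternGood hcp R₀ S y`. [folklore] -/
theorem siteGood_iff_patternGood {S : Set (EuclideanSpace ℝ (Fin 3))} {y : EuclideanSpace ℝ (Fin 3)}
    {R₀ : ℝ} (hR₀ : sInf ((fun z => dist z y) '' (S \ {y})) ≤ R₀) :
    SiteGood S y ↔ PatternGood fccKissingPattern R₀ S y ∨ PatternGood hcpKissingPattern R₀ S y := by
  simp only [SiteGood, PatternGood]
  constructor
  · rintro ⟨A, h | h⟩
    · exact Or.inl ⟨hR₀, A, h⟩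
    · exact Or.inr ⟨hR₀, A, h⟩
  · rintro (⟨-, A, h⟩ | ⟨-, A, h⟩)
    · exact ⟨A, Or.inl h⟩
    · exact ⟨A, Or.inr h⟩

/-- The scale bound recorded in `PatternGood`. [folklore] -/
theorem PatternGood.sInf_le {P : Finset (EuclideanSpace ℝ (Fin 3))} {R₀ : ℝ}
    {S : Set (EuclideanSpace ℝ (Fin 3))} {y : EuclideanSpace ℝ (Fin 3)} (h : PatternGood P R₀ S y) :
    sInf ((fun z => dist z y) '' (S \ {y})) ≤ R₀ :=
  h.1

/-- `PatternGood` is monotone in the scale bound. [folklore] -/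
theorem PatternGood.mono {P : Finset (EuclideanSpace ℝ (Fin 3))} {R₀ R₁ : ℝ}
    {S : Set (EuclideanSpace ℝ (Fin 3))} {y : EuclideanSpace ℝ (Fin 3)} (h : PatternGood P R₀ S y)
    (hR : R₀ ≤ R₁) : PatternGood P R₁ S y :=
  ⟨h.1.trans hR, h.2⟩

/-- Specification of `nearPt` when a minimiser exists. [folklore] -/
theorem nearPt_spec {Y : Set (EuclideanSpace ℝ (Fin 3))} {z : EuclideanSpace ℝ (Fin 3)}
    (h : ∃ a ∈ Y, dist a z ≤ 1 ∧ ∀ b ∈ Y, dist b z ≤ 1 → dist a z ≤ dist b z) :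
    nearPt Y z ∈ Y ∧ dist (nearPt Y z) z ≤ 1 ∧ ∀ b ∈ Y, dist b z ≤ 1 → dist (nearPt Y z) z ≤ dist b z := by
  classical
  have : nearPt Y z = h.choose := by
    unfold nearPt
    exact dif_pos h
  rw [this]
  exact ⟨h.choose_spec.1, h.choose_spec.2⟩

end Summit.AtomisticToContinuum.Crystallization.Theorems

end
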